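import Summits.RiemannHypothesis.RiemannHypothesis.Theorems.HandoffDodgerMajorant
import HarnessLib

/-!
# HANDOFF — the majorant bounds under the COUNTING cumulant bound `s_j ≤ j·A·V^j` (rh-explicit, W-P(P2) crux 19185, seat dodger-p2 gen0; DODGER-STAGE2-PLAN §2 (c) brick B3-ii)

RH-FREE. HONEST FRAMING: nothing here bears on the truth of RH; elementary real analysis on top of gen10's
`HandoffDodgerMajorant` (majorant sequence + discrete Grönwall, abstract in the cumulant bounds `s_j`). gen10 specialises the
cumulant polynomial `G_n(u) = Σ_{m<n−1} s_{m+2}u^{m+2}/(m+2)` to the GEOMETRIC bound `s_j ≤ j·W^{j−1}·P` (`cumulantSum_le`: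
`G_n(u) ≤ 2PWu²` for `Wu ≤ ½`). With the COUNTING bound of `HandoffDodgerCountingCumulants.norm_dodgerPowerSum_le_counting`
(ATTEMPT-16 Lemma B3) one has instead `s_j ≤ j·A·V^j` (`V = T₀²`, `A ≈ T₀/(25π)`), and THIS FILE gives the corresponding forms:
`G_n(u) ≤ A·(Vu)²/(1 − Vu)` for `0 ≤ Vu < 1` (`cumulantSum_le_counting`), hence
`‖h_n − (−p)ⁿ/n!‖ ≤ (pⁿ/n!)·(exp(A(Vn/p)²/(1 − Vn/p)) − 1)` for `V·n < p` (`norm_sub_le_of_counting`) and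
`‖h_n‖ ≤ e^{pu + A(Vu)²/(1−Vu)}/uⁿ` (`norm_le_of_counting`) — ATTEMPT-16 Lemma D1's `e^{g(n)} − 1`, `g(n) ≤ κT₂u_n²/(1−u_n)`.
No `sorry`, standard axioms, no definitions.

References: this track (ATTEMPT-16 §5 Lemma D1 (i); ATTEMPT-19 §2; HOME/rh-explicit-dodger-p2/DODGER-STAGE2-PLAN.md §2).
-/

set_option linter.dupNamespace false

noncomputable section

open Finset

namespace Summit.RiemannHypothesis.RiemannHypothesis.Theorems.Handoff

/-- If `s_j ≤ j·A·V^j` for `j ≥ 2` (`A, V ≥ 0`) then `G_n(u) ≤ A·(Vu)²/(1 − Vu)` whenever `0 ≤ u` and `Vu < 1`.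
[this track, ATTEMPT-16 §5 Lemma D1 (i); DODGER-STAGE2-PLAN §2] -/
theorem cumulantSum_le_counting {s : ℕ → ℝ} {A V : ℝ} (hA : 0 ≤ A) (hV : 0 ≤ V)
    (hs : ∀ j, 2 ≤ j → s j ≤ (j : ℝ) * A * V ^ j) (n : ℕ) {u : ℝ} (hu : 0 ≤ u) (hVu : V * u < 1) :
    ∑ m ∈ Finset.range (n - 1), s (m + 2) / ((m : ℝ) + 2) * u ^ (m + 2) ≤ A * (V * u) ^ 2 / (1 - V * u) := by
  have hx0 : 0 ≤ V * u := mul_nonneg hV hu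
  have hterm : ∀ m ∈ Finset.range (n - 1),
      s (m + 2) / ((m : ℝ) + 2) * u ^ (m + 2) ≤ A * (V * u) ^ 2 * (V * u) ^ m := by
    intro m _
    have h1 : s (m + 2) / ((m : ℝ) + 2) ≤ A * V ^ (m + 2) := by
      rw [div_le_iff₀ (by positivity)]
      have := hs (m + 2) (by omega)
      push_cast at this
      linarith
    calc s (m + 2) / ((m : ℝ) + 2) * u ^ (m + 2) ≤ A * V ^ (m + 2) * u ^ (m + 2) :=
          mul_le_mul_of_nonneg_right h1 (pow_nonneg hu _)
      _ = A * (V * u) ^ 2 * (V * u) ^ m := by ring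
  refine (Finset.sum_le_sum hterm).trans ?_
  rw [← Finset.mul_sum]
  have hgeom : ∑ m ∈ Finset.range (n - 1), (V * u) ^ m ≤ 1 / (1 - V * u) := by
    have h := geom_sum_Ico_le_of_lt_one (m := 0) (n := n - 1) hx0 hVu
    rw [pow_zero] at h
    rwa [Finset.range_eq_Ico]
  have h1 : 0 < 1 - V * u := by linarith
  calc A * (V * u) ^ 2 * ∑ m ∈ Finset.range (n - 1), (V * u) ^ m ≤ A * (V * u) ^ 2 * (1 / (1 - V * u)) :=
        mul_le_mul_of_nonneg_left hgeom (by positivity)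
    _ = A * (V * u) ^ 2 / (1 - V * u) := by field_simp

/-- **Main-range bound, counting form**: `‖h_n − (−p)ⁿ/n!‖ ≤ (pⁿ/n!)(exp(A(Vn/p)²/(1 − Vn/p)) − 1)` when `V·n < p`.
[this track, ATTEMPT-16 Lemma D1 (i)–(ii); DODGER-STAGE2-PLAN §2] -/
theorem norm_sub_le_of_counting {S r h : ℕ → ℂ} {A V p : ℝ} (hp : 0 < p) (hA : 0 ≤ A) (hV : 0 ≤ V)
    (hr0 : r 0 = 1)
    (hrec : ∀ n : ℕ, ((n : ℂ) + 1) * r (n + 1) = -∑ i ∈ Finset.range n, S (i + 2) * r (n - 1 - i))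
    (hS : ∀ j, 2 ≤ j → ‖S j‖ ≤ (j : ℝ) * A * V ^ j)
    (hconv : ∀ n : ℕ, h n = ∑ j ∈ Finset.range (n + 1), ((-p : ℝ) : ℂ) ^ (n - j) / ((n - j).factorial : ℂ) * r j)
    {n : ℕ} (hn : V * n < p) :
    ‖h n - ((-p : ℝ) : ℂ) ^ n / (n.factorial : ℂ)‖ ≤
      p ^ n / (n.factorial : ℝ) * (Real.exp (A * (V * (n : ℝ) / p) ^ 2 / (1 - V * (n : ℝ) / p)) - 1) := by
  have h1 := norm_sub_le_mul_expm1 hp hr0 hrec hS hconv n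
  refine h1.trans (mul_le_mul_of_nonneg_left ?_ (by positivity))
  have hu : 0 ≤ (n : ℝ) / p := by positivity
  have hVu : V * ((n : ℝ) / p) < 1 := by
    rw [← mul_div_assoc, div_lt_one hp]; exact hn
  have h2 := cumulantSum_le_counting (s := fun j => (j : ℝ) * A * V ^ j) hA hV (fun j _ => le_rfl) n hu hVu
  have h3 : A * (V * ((n : ℝ) / p)) ^ 2 / (1 - V * ((n : ℝ) / p)) = A * (V * (n : ℝ) / p) ^ 2 / (1 - V * (n : ℝ) / p) := by
    rw [← mul_div_assoc]
  rw [h3] at h2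
  linarith [Real.exp_le_exp.2 h2]

/-- **Tail bound, counting form**: `‖h_n‖ ≤ e^{pu + A(Vu)²/(1−Vu)}/uⁿ` for every `u > 0` with `Vu < 1`. [this track, DODGER-STAGE2-PLAN §2] -/
theorem norm_le_of_counting {S r h : ℕ → ℂ} {A V p : ℝ} (hp : 0 ≤ p) (hA : 0 ≤ A) (hV : 0 ≤ V)
    (hr0 : r 0 = 1)
    (hrec : ∀ n : ℕ, ((n : ℂ) + 1) * r (n + 1) = -∑ i ∈ Finset.range n, S (i + 2) * r (n - 1 - i))
    (hS : ∀ j, 2 ≤ j → ‖S j‖ ≤ (j : ℝ) * A * V ^ j)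
    (hconv : ∀ n : ℕ, h n = ∑ j ∈ Finset.range (n + 1), ((-p : ℝ) : ℂ) ^ (n - j) / ((n - j).factorial : ℂ) * r j)
    (n : ℕ) {u : ℝ} (hu : 0 < u) (hVu : V * u < 1) :
    ‖h n‖ ≤ Real.exp (p * u + A * (V * u) ^ 2 / (1 - V * u)) / u ^ n := by
  have h1 := norm_le_exp_div_pow hp hr0 hrec hS hconv n hu
  refine h1.trans (div_le_div_of_nonneg_right (Real.exp_le_exp.2 ?_) (pow_nonneg hu.le _))
  have h2 := cumulantSum_le_counting (s := fun j => (j : ℝ) * A * V ^ j) hA hV (fun j _ => le_rfl) n hu.le hVu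
  linarith

end Summit.RiemannHypothesis.RiemannHypothesis.Theorems.Handoff

end
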